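import Mathlib
import Summits.MatrixMultiplication.Statement
import Summits.MatrixMultiplication.MatrixMultiplication.Theorems.GraphEquationsQuarticSpecimen

/-!
# The cubic ladder: `¬ TowerReach 4 1 K` for every `K` (`GraphEquations`, M81)

Decomp-mm node «GraphEquations» (lens 5); attacked leaf `MultiplicityReduction` (stmt-MatrixMultiplication-27806);
node target VERBATIM `_root_.MatrixMultiplication`; the cut `closes (hV : GraphEquationsQuadratic)
(hM : MultiplicityReduction)` is untouched — this file sits under `hM` via the kernel-tower dial `TowerReach` (M79).
**Decided: «∃ K, TowerReach 4 1 K» is FALSE** (`not_towerReach_four_one`; M80 had `K ≤ 2`): at test degree `4`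
ONE round of differentiation along a kernel field reaches NO finite order (corollary `not_kernelFieldClauseDeg_four`).
**Specimen** (CUBIC LADDER, levels `j ≤ L`, `n ≥ L + 3`; `ladderRole`): level `j` owns row `j`, columns `r ≤ L + 2`
— `B_j = (j,0)` FREE, `(j,1)` a linear and `(j,2)` a cubic slave (M80's carrier, absorber `f_{(j+1,0)}²`), a squaring
tower and the top square `f_{(j,L+2)}²`; `f_q` elsewhere; correct, degree `≤ 4`; kernel fields `μ_ℓ = −α μ_B`, `μ = 0`
on slaves/towers, `b_j = μ_{B_j}` FREE.  **Mechanism (weight doubling)**: `D_μ u_j ≡ −3 b_j F_{B_j}² − 2 b_{j+1} F_{B_{j+1}}`;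
along `F_{B_j} = c_j s^{2^j}` (`2 b_{j+1} c_{j+1} = −3 b_j c_j²`) all of `T ∪ D_μ T` vanishes EXACTLY except
`D_μ u_L = −3 b_L c_L² s^{2^{L+1}}` (if some `b_k = 0`, `F_{B_k} = s` does), and the JET certificate
`not_idealInitIsolatedSet_of_jetCert` (M80's `arcHom u x` is the jet `u s + x s²`) forbids every order `K < 2^{L+1}`.
No `sorry`.  Sources: Leykin–Verschelde–Zhao [doi:10.1016/j.tcs.2006.02.018] §4; [BurgisserClausenShokrollahi1997, 16.3].
-/

set_option linter.dupNamespace false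

noncomputable section

namespace Summit.MatrixMultiplication.MatrixMultiplication.Theorems.GraphEquations

open MvPolynomial Matrix Literature.Computability.AlgebraicComplexity Literature.Computability.AlgebraicComplexity.ArithCircuit

variable {n : ℕ}

section JetCert

variable (γ : Fin n × Fin n → Polynomial ℂ)

/-- The jet of a monomial along an arc through the origin: `g F^d ↦ s^{|d|} · g ∏_v (γ_v/s)^{d_v}`. -/
theorem aeval_jet_monomial (hγ : ∀ v, (γ v).coeff 0 = 0) (d : Fin n × Fin n →₀ ℕ) (g : ℂ) :
    aeval γ (monomial d g) = Polynomial.X ^ d.degree * (Polynomial.C g * ∏ v, (γ v).divX ^ d v) := by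
  have hv : ∀ v, γ v ^ d v = Polynomial.X ^ d v * (γ v).divX ^ d v := fun v => by
    rw [← mul_pow]; conv_lhs => rw [← Polynomial.X_mul_divX_add (γ v), hγ v, map_zero, add_zero]
  rw [aeval_monomial, Finsupp.prod_fintype _ _ (fun v => by simp), Finsupp.degree_eq_sum, Polynomial.algebraMap_eq]
  simp only [hv, Finset.prod_mul_distrib, Finset.prod_pow_eq_pow_sum]; ring

/-- **Order count (jet form)**: if the components of `G` below `ν` vanish, `[s^ν] G(γ(s)) = G_ν(γ'(0))`. -/
theorem coeff_aeval_jet (hγ : ∀ v, (γ v).coeff 0 = 0) (G : MvPolynomial (Fin n × Fin n) ℂ) {ν : ℕ}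
    (hlow : ∀ j < ν, homogeneousComponent j G = 0) :
    (aeval γ G).coeff ν = eval (fun v => (γ v).coeff 1) (homogeneousComponent ν G) := by
  classical
  have hdeg : ∀ d ∈ G.support, ν ≤ d.degree := fun d hd => not_lt.1 fun hlt => (mem_support_iff.1 hd) (by
    simpa [coeff_homogeneousComponent] using congr_arg (coeff d) (hlow _ hlt))
  have h1 : ∀ p : Polynomial ℂ, Polynomial.eval 0 p.divX = p.coeff 1 := fun p => by
    rw [← Polynomial.coeff_zero_eq_eval_zero, Polynomial.coeff_divX]
  (conv_lhs => rw [G.as_sum, map_sum, Polynomial.finsetSum_coeff]); rw [homogeneousComponent_apply, map_sum, Finset.sum_filter]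
  refine Finset.sum_congr rfl fun d hd => ?_
  rw [aeval_jet_monomial γ hγ, Polynomial.coeff_X_pow_mul', eval_monomial, Finsupp.prod_fintype _ _ (fun v => by simp)]
  by_cases hdν : d.degree = ν
  · rw [if_pos hdν.le, if_pos hdν, hdν, Nat.sub_self, Polynomial.coeff_zero_eq_eval_zero]; simp [Polynomial.eval_prod, h1]
  · rw [if_neg (fun h => hdν (le_antisymm h (hdeg d hd))), if_neg hdν]

/-- **Jet certificate.**  If over the base pair `y` every `t ∈ S`, in fibre coordinates, vanishes to order `s^N`
along an arc `F = γ(s)` through `0` with `γ'(0) ≠ 0`, then `S` is ideal-initially isolating of no order `K < N`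
over `y` (initial forms of `span S` vanish at `γ'(0)`); M80's `…_of_arcCert` is the jet `γ_v = u_v s + x_v s²`. -/
theorem not_idealInitIsolatedSet_of_jetCert (hγ : ∀ v, (γ v).coeff 0 = 0) {S : Set (MvPolynomial (GraphVars n) ℂ)}
    {K N : ℕ} (hKN : K < N) {y : MatMulVars n → ℂ}
    (hdiv : ∀ t ∈ S, Polynomial.X ^ N ∣ aeval γ (map (eval y) (liftF n t)))
    (hu : (fun v => (γ v).coeff 1) ≠ 0) : ¬ IdealInitIsolatedSet S K y := by
  classical
  rintro ⟨T, w, hw, ν, G, hν, hG, hlow, hiso⟩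
  let Φ : MvPolynomial (GraphVars n) ℂ →+* Polynomial ℂ := ((aeval γ).toRingHom.comp (map (eval y))).comp (liftF n).toRingHom
  have hspan : Ideal.span S ≤ Ideal.comap Φ (Ideal.span {Polynomial.X ^ N}) := by
    rw [Ideal.span_le]; exact fun t ht => Ideal.mem_span_singleton.2 (hdiv t ht)
  have hcoef : ∀ i, 1 ≤ ν i → eval (fun v => (γ v).coeff 1) (map (eval y) (homogeneousComponent (ν i) (G i))) = 0 :=
    fun i hi => by
    obtain ⟨p, hp⟩ : Polynomial.X ^ N ∣ aeval γ (map (eval y) (G i)) := by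
      simpa [Φ, liftF_substF, ← hG i] using Ideal.mem_span_singleton.1 (Ideal.mem_comap.1 (hspan (hw i)))
    rw [← homogeneousComponent_map, ← coeff_aeval_jet γ hγ _ fun j hj => by
      rw [homogeneousComponent_map, hlow i j hj, map_zero], hp, Polynomial.coeff_X_pow_mul', if_neg (by have := hν i; omega)]
  refine hu (hiso _ fun i => ?_)
  rcases Nat.eq_zero_or_pos (ν i) with h0 | hpos
  · rw [h0, eq_C_of_isHomogeneous_zero ((homogeneousComponent_isHomogeneous 0 (G i)).map (eval y)), eval_C, eval_C]
  · rw [eval_zero_of_isHomogeneous ((homogeneousComponent_isHomogeneous _ (G i)).map (eval y)) hpos.ne', hcoef i hpos]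

end JetCert

section Ladder

variable (L : ℕ) (hL : L + 3 ≤ n)

/-- Position `(j, r)` (indices read modulo `n`; only rows `j ≤ L + 1` and columns `r ≤ L + 2 < n` are used). -/
def pp (j r : ℕ) : Fin n × Fin n :=
  have hn : 0 < n := Nat.lt_of_lt_of_le zero_lt_three (Nat.le_trans (Nat.le_add_left 3 L) hL)
  (⟨j % n, Nat.mod_lt _ hn⟩, ⟨r % n, Nat.mod_lt _ hn⟩)

/-- In range, `pp j r` has coordinates `(j, r)`. -/
theorem pp_val {j r : ℕ} (hj : j < n) (hr : r < n) : ((pp L hL j r).1 : ℕ) = j ∧ ((pp L hL j r).2 : ℕ) = r :=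
  ⟨Nat.mod_eq_of_lt hj, Nat.mod_eq_of_lt hr⟩

/-- `f_{(j,r)}`. -/
def lf (j r : ℕ) : MvPolynomial (GraphVars n) ℂ := generator n (pp L hL j r)

/-- `c_{(j,r)}`. -/
def lc (j r : ℕ) : MvPolynomial (GraphVars n) ℂ := X (Sum.inr (pp L hL j r))

/-- The test hosted at column `r` of level `j`: top square `f_{(j,L+2)}²`, linear slave `f_ℓ + c_B f_B − f_B²`, cubic
slave `f_Z − K_j − f_{(j+1,0)}²` (`K_j = f_B c_B² + 2 f_ℓ f_B + c_B f_ℓ − f_B f_ℓ`), squaring tower `f_{(j,r+3)} − f_{(j,r+2)}²`. -/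
def ladderRole (j : ℕ) : ℕ → MvPolynomial (GraphVars n) ℂ
  | 0 => lf L hL j (L + 2) * lf L hL j (L + 2)
  | 1 => lf L hL j 1 + lc L hL j 0 * lf L hL j 0 - lf L hL j 0 * lf L hL j 0
  | 2 => lf L hL j 2 - (lf L hL j 0 * lc L hL j 0 * lc L hL j 0 + (lf L hL j 1 * lf L hL j 0 + lf L hL j 1 * lf L hL j 0)
      + lc L hL j 0 * lf L hL j 1 - lf L hL j 0 * lf L hL j 1) - lf L hL (j + 1) 0 * lf L hL (j + 1) 0
  | r + 3 => lf L hL j (r + 3) - lf L hL j (r + 2) * lf L hL j (r + 2)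

/-- The cubic ladder's tests: the level tests on rows `≤ L`, columns `≤ L + 2`, and `f_q` elsewhere. -/
def ladderTest (q : Fin n × Fin n) : MvPolynomial (GraphVars n) ℂ :=
  if (q.1 : ℕ) ≤ L ∧ (q.2 : ℕ) ≤ L + 2 then ladderRole L hL q.1 q.2 else generator n q

/-- Fibre coordinates over a base pair (`a j = α_{(j,0)}(y)`): the linear slave form `ŝ_j = F_ℓ + a_j F_B`. -/
def lS (a : ℕ → ℂ) (j : ℕ) : MvPolynomial (Fin n × Fin n) ℂ := X (pp L hL j 1) + C (a j) * X (pp L hL j 0)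

/-- The specialised lifts of the level tests: `F_T², ŝ, F_Z − F_B³ − (2F_B + a)ŝ − F_{B'}², F_{r+3} − F_{r+2}²`. -/
def ladderFibRole (a : ℕ → ℂ) (j : ℕ) : ℕ → MvPolynomial (Fin n × Fin n) ℂ
  | 0 => X (pp L hL j (L + 2)) * X (pp L hL j (L + 2))
  | 1 => lS L hL a j
  | 2 => X (pp L hL j 2) - X (pp L hL j 0) * X (pp L hL j 0) * X (pp L hL j 0)
      - (2 * X (pp L hL j 0) + C (a j)) * lS L hL a j - X (pp L hL (j + 1) 0) * X (pp L hL (j + 1) 0)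
  | r + 3 => X (pp L hL j (r + 3)) - X (pp L hL j (r + 2)) * X (pp L hL j (r + 2))

/-- The specialised lifts of all tests. -/
def ladderFib (a : ℕ → ℂ) (q : Fin n × Fin n) : MvPolynomial (Fin n × Fin n) ℂ :=
  if (q.1 : ℕ) ≤ L ∧ (q.2 : ℕ) ≤ L + 2 then ladderFibRole L hL a q.1 q.2 else X q

/-- The `Z`-value of the ladder arc at level `j`: `β_j³ + β_{j+1}²`. -/
def arcZ (β : ℕ → Polynomial ℂ) (j : ℕ) : Polynomial ℂ := β j ^ 3 + β (j + 1) ^ 2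

/-- The ladder arc at column `r` of level `j`: `β_j, −a_j β_j, (β_j³ + β_{j+1}²)^{2^r}` (`r ↦ r + 2`). -/
def ladderArcRole (a : ℕ → ℂ) (β : ℕ → Polynomial ℂ) (j : ℕ) : ℕ → Polynomial ℂ
  | 0 => β j
  | 1 => -(Polynomial.C (a j) * β j)
  | r + 2 => arcZ β j ^ 2 ^ r

/-- **The ladder arc generated by `β`** (zero off the active positions). -/
def ladderArc (a : ℕ → ℂ) (β : ℕ → Polynomial ℂ) (q : Fin n × Fin n) : Polynomial ℂ :=
  if (q.1 : ℕ) ≤ L ∧ (q.2 : ℕ) ≤ L + 2 then ladderArcRole a β q.1 q.2 else 0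

/-- At an active position the test, its specialised lift and the ladder arc are the level data. -/
theorem active_pp (a : ℕ → ℂ) (β : ℕ → Polynomial ℂ) {j r : ℕ} (hj : j ≤ L) (hr : r ≤ L + 2) :
    ladderTest L hL (pp L hL j r) = ladderRole L hL j r ∧ ladderFib L hL a (pp L hL j r) = ladderFibRole L hL a j r ∧
      ladderArc L a β (pp L hL j r) = ladderArcRole a β j r := by
  obtain ⟨h1, h2⟩ := pp_val L hL (j := j) (r := r) (by omega) (by omega)
  simp only [ladderTest, ladderFib, ladderArc, h1, h2, hj, hr, and_self, if_true]

/-- The ladder arc at the absorber position `(j+1, 0)` of level `j ≤ L` (zero above the top level). -/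
theorem ladderArc_succ (a : ℕ → ℂ) (β : ℕ → Polynomial ℂ) (hβL : β (L + 1) = 0) {j : ℕ} (hj : j ≤ L) :
    ladderArc L a β (pp L hL (j + 1) 0) = β (j + 1) := by
  obtain ⟨h1, h2⟩ := pp_val L hL (j := j + 1) (r := 0) (by omega) (by omega)
  rcases Nat.lt_or_ge j L with hjL | hjL
  · simp only [ladderArc, h1, h2, show j + 1 ≤ L from hjL, Nat.zero_le, and_self, if_true, ladderArcRole]
  · obtain rfl : j = L := le_antisymm hj hjL
    simp only [ladderArc, h1, show ¬(j + 1 ≤ j) from Nat.not_succ_le_self j, false_and, if_false, hβL]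

/-- `(lift t_q)(y) = G_q(α(y))`. -/
theorem map_liftF_ladderTest (y : MatMulVars n → ℂ) (q : Fin n × Fin n) :
    map (eval y) (liftF n (ladderTest L hL q)) = ladderFib L hL (fun j => eval y (abBase n (pp L hL j 0))) q := by
  unfold ladderTest ladderFib; split_ifs
  · rcases q with ⟨⟨j, -⟩, ⟨_ | _ | _ | r, -⟩⟩ <;>
      simp [ladderRole, ladderFibRole, lf, lc, lS, liftF_generator, liftF_X_inr_eq, map_X, map_C] <;> ring
  · rw [liftF_generator, map_X]

/-- The tests have degree `≤ 4`. -/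
theorem totalDegree_ladderTest_le (q : Fin n × Fin n) : (ladderTest L hL q).totalDegree ≤ 4 := by
  have hf : ∀ j r, (lf L hL j r).totalDegree ≤ 2 := fun j r => totalDegree_generator_le_two n _
  have hc : ∀ j r, (lc L hL j r).totalDegree ≤ 1 := fun j r => (totalDegree_X _).le
  have add : ∀ {p q : MvPolynomial (GraphVars n) ℂ}, p.totalDegree ≤ 4 → q.totalDegree ≤ 4 →
      (p + q).totalDegree ≤ 4 := fun hp hq => (totalDegree_add _ _).trans (max_le hp hq)
  have sub : ∀ {p q : MvPolynomial (GraphVars n) ℂ}, p.totalDegree ≤ 4 → q.totalDegree ≤ 4 →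
      (p - q).totalDegree ≤ 4 := fun hp hq => (totalDegree_sub _ _).trans (max_le hp hq)
  have mul : ∀ {p q : MvPolynomial (GraphVars n) ℂ} {a b : ℕ}, p.totalDegree ≤ a → q.totalDegree ≤ b →
      a + b ≤ 4 → (p * q).totalDegree ≤ 4 := fun hp hq h => (totalDegree_mul _ _).trans ((add_le_add hp hq).trans h)
  unfold ladderTest; split_ifs
  · rcases q with ⟨⟨j, -⟩, ⟨_ | _ | _ | r, -⟩⟩
    · exact mul (hf _ _) (hf _ _) le_rfl
    · exact sub (add ((hf _ _).trans (by norm_num)) (mul (hc _ _) (hf _ _) (by norm_num))) (mul (hf _ _) (hf _ _) le_rfl)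
    · exact sub (sub ((hf _ _).trans (by norm_num)) (sub (add (add ((totalDegree_mul _ _).trans (add_le_add ((totalDegree_mul _ _).trans
        (add_le_add (hf _ _) (hc _ _))) (hc _ _))) (add (mul (hf _ _) (hf _ _) le_rfl) (mul (hf _ _) (hf _ _) le_rfl)))
        (mul (hc _ _) (hf _ _) (by norm_num))) (mul (hf _ _) (hf _ _) le_rfl))) (mul (hf _ _) (hf _ _) le_rfl)
    · exact sub ((hf _ _).trans (by norm_num)) (mul (hf _ _) (hf _ _) le_rfl)
  · exact (totalDegree_generator_le_two n _).trans (by norm_num)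

/-- **Correctness**: the tests cut out `W_n` (tops, towers `⇒ f_Z = 0`; `f_{B_L}³ = 0, …, f_{B_0}³ = 0`; slaves). -/
theorem ladderTest_zero_iff (x : GraphVars n → ℂ) : (∀ q, eval x (ladderTest L hL q) = 0) ↔ x ∈ mmGraph n := by
  refine ⟨fun h => (mem_mmGraph_iff_eval_generator x).2 fun q => ?_, fun hx q => ?_⟩
  · obtain ⟨g, hg⟩ : ∃ g : ℕ → ℕ → ℂ, ∀ j r, eval x (lf L hL j r) = g j r := ⟨_, fun _ _ => rfl⟩
    obtain ⟨A, hA⟩ : ∃ A : ℕ → ℂ, ∀ j, eval x (lc L hL j 0) = g j 0 + A j :=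
      ⟨fun j => eval x (liftAB n (abBase n (pp L hL j 0))), fun j => by rw [← hg]; simp only [liftAB_abBase, map_sub]; simp [lc, lf]⟩
    have hrole : ∀ j r, j ≤ L → r ≤ L + 2 → eval x (ladderRole L hL j r) = 0 := fun j r hj hr => by
      rw [← (active_pp L hL A (fun _ => 0) hj hr).1]; exact h _
    have hplain : ∀ q : Fin n × Fin n, ¬((q.1 : ℕ) ≤ L ∧ (q.2 : ℕ) ≤ L + 2) → eval x (generator n q) = 0 :=
      fun q hq => by have e := h q; rwa [ladderTest, if_neg hq] at e
    have htow : ∀ j ≤ L, ∀ i r, r + i = L → g j (r + 2) = 0 := fun j hj i => by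
      induction i with
      | zero =>
        intro r hr; obtain rfl : r = L := by omega
        have e := hrole j 0 hj (by omega); simp only [ladderRole, map_mul, hg] at e; exact mul_self_eq_zero.1 e
      | succ i ih =>
        intro r hr; have e := hrole j (r + 3) hj (by omega)
        simp only [ladderRole, map_sub, map_mul, hg, ih (r + 1) (by omega)] at e
        exact mul_self_eq_zero.1 (by linear_combination -e)
    have hZ : ∀ j ≤ L, g j 2 = 0 := fun j hj => htow j hj L 0 (by omega)
    have hlev : ∀ j ≤ L, g (j + 1) 0 = 0 → g j 0 = 0 := fun j hj h1 => by
      have e1 := hrole j 1 hj (by omega); have e2 := hrole j 2 hj (by omega)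
      simp only [ladderRole, map_add, map_sub, map_mul, hg, hA, hZ j hj, h1] at e1 e2
      exact pow_eq_zero_iff (n := 3) (by norm_num) |>.1 (by linear_combination -e2 - (2 * g j 0 + A j) * e1)
    have hB : ∀ i j, j + i = L → g j 0 = 0 := fun i => by
      induction i with
      | zero => exact fun j hj => hlev j (by omega) (by rw [← hg]; exact hplain _ (by
          rw [(pp_val L hL (j := j + 1) (r := 0) (by omega) (by omega)).1]; omega))
      | succ i ih => exact fun j hj => hlev j (by omega) (ih (j + 1) (by omega))
    rcases q with ⟨⟨j, hjn⟩, ⟨r, hrn⟩⟩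
    by_cases hq : j ≤ L ∧ r ≤ L + 2
    · rw [← show pp L hL j r = (⟨j, hjn⟩, ⟨r, hrn⟩) from
        Prod.ext (Fin.ext (Nat.mod_eq_of_lt hjn)) (Fin.ext (Nat.mod_eq_of_lt hrn)), ← lf, hg]
      rcases r with _ | _ | r
      · exact hB (L - j) j (by omega)
      · have e1 := hrole j 1 hq.1 (by omega)
        simp only [ladderRole, map_add, map_sub, map_mul, hg, hA, hB (L - j) j (by omega)] at e1; linear_combination e1
      · exact htow j hq.1 (L - r) r (by omega)
    · exact hplain _ hq
  · have hg : ∀ q, eval x (generator n q) = 0 := (mem_mmGraph_iff_eval_generator x).1 hx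
    unfold ladderTest; split_ifs
    · rcases q with ⟨⟨j, -⟩, ⟨_ | _ | _ | r, -⟩⟩ <;> simp [ladderRole, lf, hg]
    · exact hg q

/-- **The ladder arc kills `T ∪ D_μ T` to order `s^{2^{L+1}}`** whenever `β` solves the absorption conditions
`s^{2^{L+1}} ∣ 3 b_j β_j² + 2 b_{j+1} β_{j+1}` (`j ≤ L`; `β_{L+1} = 0`) for the kernel value `m` (`m_ℓ = −a b`, …). -/
theorem ladderArc_dvd (a b : ℕ → ℂ) (β : ℕ → Polynomial ℂ) (m : Fin n × Fin n → ℂ)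
    (hX : ∀ j, Polynomial.X ∣ β j) (hβL : β (L + 1) = 0) (hb : ∀ j, m (pp L hL j 0) = b j)
    (k1 : ∀ j ≤ L, m (pp L hL j 1) = -(a j * b j)) (k2 : ∀ j ≤ L, ∀ r, 2 ≤ r → r ≤ L + 2 → m (pp L hL j r) = 0)
    (k3 : ∀ q : Fin n × Fin n, ¬((q.1 : ℕ) ≤ L ∧ (q.2 : ℕ) ≤ L + 2) → m q = 0)
    (hS : ∀ j ≤ L, Polynomial.X ^ 2 ^ (L + 1) ∣
      3 * Polynomial.C (b j) * β j ^ 2 + 2 * Polynomial.C (b (j + 1)) * β (j + 1)) (q : Fin n × Fin n) :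
    Polynomial.X ^ 2 ^ (L + 1) ∣ aeval (ladderArc L a β) (ladderFib L hL a q) ∧
      Polynomial.X ^ 2 ^ (L + 1) ∣ aeval (ladderArc L a β) (polarDeriv m (ladderFib L hL a q)) := by
  classical
  by_cases hq : (q.1 : ℕ) ≤ L ∧ (q.2 : ℕ) ≤ L + 2
  swap
  · rw [ladderFib, if_neg hq, polarDeriv_X, k3 q hq, map_zero, map_zero, aeval_X, ladderArc, if_neg hq]
    exact ⟨dvd_zero _, dvd_zero _⟩
  obtain ⟨⟨j, hjn⟩, ⟨r, hrn⟩⟩ := q; obtain ⟨hj, hr⟩ : j ≤ L ∧ r ≤ L + 2 := hq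
  rw [show ladderFib L hL a (⟨j, hjn⟩, ⟨r, hrn⟩) = ladderFibRole L hL a j r from if_pos ⟨hj, hr⟩]
  have hZX : Polynomial.X ∣ arcZ β j := dvd_add (dvd_pow (hX _) three_ne_zero) (dvd_pow (hX _) two_ne_zero)
  have A : ∀ r', r' ≤ L + 2 → aeval (ladderArc L a β) (X (pp L hL j r') : MvPolynomial (Fin n × Fin n) ℂ) =
      ladderArcRole a β j r' := fun r' h => by rw [aeval_X, (active_pp L hL a β hj h).2.2]
  have A' : aeval (ladderArc L a β) (X (pp L hL (j + 1) 0) : MvPolynomial (Fin n × Fin n) ℂ) = β (j + 1) := by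
    rw [aeval_X, ladderArc_succ L hL a β hβL hj]
  have AS : aeval (ladderArc L a β) (lS L hL a j) = 0 := by
    rw [lS, map_add, map_mul, A 0 (by omega), A 1 (by omega), aeval_C, Polynomial.algebraMap_eq, ladderArcRole,
      ladderArcRole]; ring
  have PS : aeval (ladderArc L a β) (polarDeriv m (lS L hL a j)) = 0 := by
    rw [lS, polarDeriv_add, polarDeriv_C_mul, polarDeriv_X, polarDeriv_X, k1 j hj, hb]; simp
  rcases r with _ | _ | _ | r
  · refine ⟨?_, by rw [ladderFibRole, polarDeriv_mul, polarDeriv_X, k2 j hj (L + 2) (by omega) le_rfl]; simp⟩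
    rw [ladderFibRole, map_mul, A (L + 2) le_rfl, ladderArcRole, ← pow_add, ← two_mul, ← pow_succ']
    exact pow_dvd_pow_of_dvd hZX _
  · rw [ladderFibRole, AS, PS]; exact ⟨dvd_zero _, dvd_zero _⟩
  · refine ⟨?_, ?_⟩
    · simp only [ladderFibRole, map_sub, map_add, map_mul, map_ofNat, aeval_C, Polynomial.algebraMap_eq, AS, mul_zero,
        A', A 0 (Nat.zero_le _), A 2 (by omega), ladderArcRole, pow_zero, pow_one]
      exact ⟨0, by rw [arcZ]; ring⟩
    · obtain ⟨w, hw⟩ := hS j hj; refine ⟨-w, ?_⟩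
      simp only [ladderFibRole, polarDeriv_sub', polarDeriv_add, polarDeriv_mul, polarDeriv_X, polarDeriv_C,
        polarDeriv_ofNat, map_sub, map_add, map_mul, map_ofNat, add_zero, zero_mul, A 0 (Nat.zero_le _), A', AS, PS,
        ladderArcRole, k2 j hj 2 le_rfl (by omega), hb, map_zero, aeval_C, Polynomial.algebraMap_eq, mul_zero,
        zero_add, sub_zero]
      linear_combination -hw
  · refine ⟨?_, ?_⟩
    · rw [ladderFibRole, map_sub, map_mul, A (r + 3) hr, A (r + 2) (by omega), ladderArcRole, ladderArcRole,
        ← pow_add, ← two_mul, ← pow_succ', sub_self]; exact dvd_zero _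
    · rw [ladderFibRole, polarDeriv_sub', polarDeriv_mul, polarDeriv_X, polarDeriv_X, k2 j hj (r + 3) (by omega) hr,
        k2 j hj (r + 2) (by omega) (by omega)]; simp

/-- **One round never reaches order `< 2^{L+1}` on the ladder** `T`.  Kernel fields `μ` read at a base pair `y`:
`μ_ℓ = −α_j μ_{B_j}`, `μ = 0` on slave, tower and inactive positions, `b_j = μ_{B_j}(y)` free.  If some `b_k`
(`1 ≤ k ≤ L`) vanishes, the arc `F_{B_k} = s` kills `T ∪ D_μ T` exactly; otherwise the weight-doubling arc
`F_{B_j} = c_j s^{2^j}` (`c_0 = 1`, `2 b_{j+1} c_{j+1} = −3 b_j c_j²`) kills all but `D_μ u_L = −3 b_L c_L² s^{2^{L+1}}`. -/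
theorem ladder_one_round (μ : Fin n × Fin n → MvPolynomial (MatMulVars n) ℂ)
    (hkq : ∀ q, derivC μ (ladderTest L hL q) ∈ graphIdeal n) {K : ℕ} (hK : K < 2 ^ (L + 1)) (y : MatMulVars n → ℂ) :
    ¬ IdealInitIsolatedSet (Set.range (ladderTest L hL) ∪ derivC μ '' Set.range (ladderTest L hL)) K y := by
  classical
  -- the kernel field read at `y`
  have hs : ∀ j r, j ≤ L → r ≤ L + 2 → constantCoeff (polarDeriv (fun q => eval y (μ q))
      (ladderFibRole L hL (fun k => eval y (abBase n (pp L hL k 0))) j r)) = 0 := fun j r hj hr => by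
    have h := constantCoeff_polarDeriv_of_derivC_mem (hkq (pp L hL j r)) y
    rwa [map_liftF_ladderTest, (active_pp L hL _ (fun _ => 0) hj hr).2.1] at h
  obtain ⟨b, hb⟩ : ∃ b : ℕ → ℂ, ∀ j, eval y (μ (pp L hL j 0)) = b j := ⟨_, fun _ => rfl⟩
  have k1 : ∀ j ≤ L, eval y (μ (pp L hL j 1)) = -(eval y (abBase n (pp L hL j 0)) * b j) := fun j hj => by
    have e := hs j 1 hj (by omega); simp [ladderFibRole, lS, polarDeriv_add, polarDeriv_mul, polarDeriv_X, hb] at e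
    linear_combination e
  have k2 : ∀ j ≤ L, ∀ r, 2 ≤ r → r ≤ L + 2 → eval y (μ (pp L hL j r)) = 0 := fun j hj r h2 hr => by
    rcases r with _ | _ | _ | r
    · omega
    · omega
    · have e := hs j 2 hj hr
      simp [ladderFibRole, lS, polarDeriv_add, polarDeriv_sub', polarDeriv_mul, polarDeriv_X, polarDeriv_ofNat, hb] at e
      linear_combination e + eval y (abBase n (pp L hL j 0)) * k1 j hj
    · simpa [ladderFibRole, polarDeriv_sub', polarDeriv_mul, polarDeriv_X] using hs j (r + 3) hj hr
  have k3 : ∀ q : Fin n × Fin n, ¬((q.1 : ℕ) ≤ L ∧ (q.2 : ℕ) ≤ L + 2) → eval y (μ q) = 0 := fun q hq => by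
    have h := constantCoeff_polarDeriv_of_derivC_mem (hkq q) y
    rwa [ladderTest, if_neg hq, liftF_generator, map_X, polarDeriv_X, constantCoeff_C] at h
  -- the generic step: a ladder arc generated by an admissible `β` is a jet certificate
  have step : ∀ β : ℕ → Polynomial ℂ, (∀ j, Polynomial.X ∣ β j) → β (L + 1) = 0 → (∃ j ≤ L, (β j).coeff 1 ≠ 0) →
      (∀ j ≤ L, Polynomial.X ^ 2 ^ (L + 1) ∣
        3 * Polynomial.C (b j) * β j ^ 2 + 2 * Polynomial.C (b (j + 1)) * β (j + 1)) →
      ¬ IdealInitIsolatedSet (Set.range (ladderTest L hL) ∪ derivC μ '' Set.range (ladderTest L hL)) K y := by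
    rintro β hX hβL ⟨j₀, hj₀, hne⟩ hS
    have hdv := ladderArc_dvd L hL (fun j => eval y (abBase n (pp L hL j 0))) b β (fun q => eval y (μ q))
      hX hβL hb k1 k2 k3 hS
    have h0 : ∀ v : Fin n × Fin n, (ladderArc L (fun j => eval y (abBase n (pp L hL j 0))) β v).coeff 0 = 0 :=
      fun v => by
      refine Polynomial.X_dvd_iff.1 ?_
      unfold ladderArc; split_ifs
      · rcases v with ⟨⟨j, -⟩, ⟨_ | _ | r, -⟩⟩
        exacts [hX j, (dvd_mul_of_dvd_right (hX j) _).neg_right, dvd_pow (dvd_add (dvd_pow (hX _) three_ne_zero)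
          (dvd_pow (hX _) two_ne_zero)) (pow_ne_zero _ two_ne_zero)]
      · exact dvd_zero _
    refine not_idealInitIsolatedSet_of_jetCert _ h0 hK (fun t ht => ?_) fun h => hne ?_
    · rcases ht with ⟨q, rfl⟩ | ⟨_, ⟨q, rfl⟩, rfl⟩
      · rw [map_liftF_ladderTest]; exact (hdv q).1
      · rw [map_liftF_derivC, map_liftF_ladderTest]; exact (hdv q).2
    · simpa [(active_pp L hL _ β hj₀ (Nat.zero_le _)).2.2, ladderArcRole] using congr_fun h (pp L hL j₀ 0)
  by_cases hII : ∃ k, 1 ≤ k ∧ k ≤ L ∧ b k = 0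
  · -- a vanishing free component `b_k`: the straight arc `F_{B_k} = s`
    obtain ⟨k, hk1, hkL, hbk⟩ := hII
    refine step (fun j => if j = k then Polynomial.X else 0) (fun j => ?_) (if_neg (by omega)) ⟨k, hkL, by simp⟩
      fun j hj => ?_
    · split_ifs; exacts [dvd_rfl, dvd_zero _]
    · by_cases hjk : j = k
      · subst hjk; simp [hbk]
      by_cases hjk' : j + 1 = k
      · subst hjk'; simp [hbk]
      simp [hjk, hjk']
  · -- all `b_k ≠ 0` (`1 ≤ k ≤ L`): the weight-doubling arc
    push Not at hII
    let c : ℕ → ℂ := fun j => Nat.rec (motive := fun _ => ℂ) 1 (fun i ci => -(3 * b i * ci ^ 2) / (2 * b (i + 1))) j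
    have hcs : ∀ i, c (i + 1) = -(3 * b i * c i ^ 2) / (2 * b (i + 1)) := fun i => rfl
    refine step (fun j => if j ≤ L then Polynomial.C (c j) * Polynomial.X ^ 2 ^ j else 0) (fun j => ?_)
      (if_neg (by omega)) ⟨0, Nat.zero_le _, by simp [show c 0 = 1 from rfl]⟩ fun j hj => ?_
    · split_ifs; exacts [dvd_mul_of_dvd_right (dvd_pow_self _ (pow_pos two_pos _).ne') _, dvd_zero _]
    · have key : ∀ u v : ℂ, 3 * Polynomial.C u * (Polynomial.C (c j) * Polynomial.X ^ 2 ^ j) ^ 2 +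
          2 * Polynomial.C v * (Polynomial.C (c (j + 1)) * Polynomial.X ^ 2 ^ (j + 1)) =
          Polynomial.X ^ 2 ^ (j + 1) * Polynomial.C (3 * u * c j ^ 2 + 2 * v * c (j + 1)) := fun u v => by
        rw [Nat.pow_succ, pow_mul]; simp only [map_add, map_mul, map_pow, map_ofNat]; ring
      rw [if_pos hj]; rcases Nat.lt_or_ge j L with hjL | hjL
      · rw [if_pos (by omega : j + 1 ≤ L), key]
        have hrel : 3 * b j * c j ^ 2 + 2 * b (j + 1) * c (j + 1) = 0 := by
          rw [hcs]; field_simp [hII (j + 1) (by omega) (by omega)]; ring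
        rw [hrel, map_zero, mul_zero]; exact dvd_zero _
      · obtain rfl : j = L := le_antisymm hj hjL; rw [if_neg (by omega)]
        exact ⟨Polynomial.C (3 * b j * c j ^ 2), by rw [Nat.pow_succ, pow_mul]; simp only [map_mul, map_pow, map_ofNat]; ring⟩

include hL in
/-- **The cubic ladder as a realised system** over `n ≥ L + 3`: correct, degree `≤ 4`, and for every kernel field
`μ` (including `μ = 0`, i.e. `T` itself) `T ∪ D_μ T` is ideal-initially isolating to no order `K < 2^{L+1}`. -/
theorem exists_ladderSystem : ∃ E : EqSystem n, E.Correct ∧ E.IsDegLe 4 ∧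
    ∀ μ : Fin n × Fin n → MvPolynomial (MatMulVars n) ℂ, (∀ t ∈ E.testSet, derivC μ t ∈ graphIdeal n) →
      ∀ K, K < 2 ^ (L + 1) → ∀ y, ¬ IdealInitIsolatedSet (E.testSet ∪ derivC μ '' E.testSet) K y := by
  classical
  obtain ⟨E, hfan, hto', hfrom'⟩ := exists_realisation_list ((Finset.univ : Finset (Fin n × Fin n)).toList.map (ladderTest L hL))
  have hto : ∀ o ∈ E.tests, ∃ q, E.testPoly o = ladderTest L hL q := fun o ho =>
    let ⟨q, _, hq⟩ := List.mem_map.1 (hto' o ho); ⟨q, hq.symm⟩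
  have hS : E.testSet = Set.range (ladderTest L hL) := Set.ext fun t => ⟨fun ht => by
    obtain ⟨o, ho, rfl⟩ := (E.mem_testSet_iff t).1 ht; obtain ⟨q, hq⟩ := hto o ho; exact ⟨q, hq.symm⟩, by
    rintro ⟨q, rfl⟩; exact (E.mem_testSet_iff _).2 (hfrom' _ (List.mem_map_of_mem (Finset.mem_toList.2 (Finset.mem_univ q))))⟩
  refine ⟨E, ⟨hfan, Set.ext fun x => ⟨fun hx => ?_, fun hx o ho => ?_⟩⟩, fun o => ?_, fun μ hμ K hK y => ?_⟩
  · exact (ladderTest_zero_iff L hL x).1 fun q => by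
      obtain ⟨o, ho, hq⟩ := (E.mem_testSet_iff _).1 (hS.ge (Set.mem_range_self q)); rw [← hq]; exact hx o ho
  · obtain ⟨q, hq⟩ := hto o ho; rw [hq]; exact (ladderTest_zero_iff L hL x).2 hx q
  · obtain ⟨q, hq⟩ := hto _ (List.get_mem _ o); rw [hq]; exact totalDegree_ladderTest_le L hL q
  · rw [hS] at hμ ⊢; exact ladder_one_round L hL μ (fun q => hμ _ ⟨q, rfl⟩) hK y

end Ladder

/-- **Decided: `¬ TowerReach 4 1 K` for every `K`** (the dial «∃ K, TowerReach 4 1 K» is FALSE): the cubic ladder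
with `K + 1` levels over `n = K + 3` is correct of degree `≤ 4`, and for every kernel field `μ` (height `0`: `μ = 0`)
`T ∪ D_μ T` is ideal-initially isolating to no order `K < 2^{K+1}` over any base pair. -/
theorem not_towerReach_four_one (K : ℕ) : ¬ TowerReach 4 1 K := by
  intro h; obtain ⟨E, hE, hdeg, h1⟩ := exists_ladderSystem (n := K + 3) K le_rfl
  obtain ⟨μs, hlen, hT, y, hy⟩ := h (K + 3) (by omega) E hE hdeg
  have hK : K < 2 ^ (K + 1) := Nat.lt_two_pow_self.trans (Nat.pow_lt_pow_right (by norm_num) K.lt_succ_self)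
  rcases μs with _ | ⟨μ, _ | ⟨ν, rest⟩⟩
  · exact h1 0 (fun t _ => by simp [derivC]) K hK y (hy.mono (Ideal.span_mono Set.subset_union_left))
  · exact h1 μ hT.1 K hK y hy
  · simp at hlen

/-- The granted one-line corollary: the one-round clause `KernelFieldClauseDeg 4 K` fails for EVERY `K`. -/
theorem not_kernelFieldClauseDeg_four (K : ℕ) : ¬ KernelFieldClauseDeg 4 K :=
  fun h => not_towerReach_four_one K (towerReach_one_of_kernelFieldClauseDeg h)

end Summit.MatrixMultiplication.MatrixMultiplication.Theorems.GraphEquations
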